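import Literature.NumberTheory.Transcendental.BallRivoalSeries
import Literature.NumberTheory.DiophantineApproximation.DilogHermitePade
import HarnessLib

/-!
# Type-I Hermite–Padé forms for `1, Li₁(x), …, Li_w(x)` — vocabulary (every weight)

Topic `Literature/NumberTheory/DiophantineApproximation`. The every-weight version of
`DilogHermitePade.lean`: for a weight `w ≥ 1` the classical type-I Hermite–Padé kernel
(Nikišin 1979; Hata 1990; David–Hirata-Kohno–Kawashima 2020, Thm 2.1) is

  `R^{(w)}_n(u) = ∏_{j<wn} (u − j) / ∏_{p ≤ n} (u + p + 1)^w = (u − wn + 1)_{wn} / (u + 1)_{n+1}^w`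

(`kernelW w n u`, a rational function of `u : ℚ` written with the Pochhammer products
`BallRivoal.poch` of the tree's Ball–Rivoal files, poles at `−1, …, −(n+1)` as there), and the form is
`S^{(w)}_n(x) = ∑_{u ≥ 0} R^{(w)}_n(u) x^{u+1}` (`formW w n x`; for `w = 2`,
`kernelW 2 n u = DilogPade.kernel n (u + 1)`). The numerator kills the first `wn` coefficients, so
`0 < S^{(w)}_n(1/N) ≤ N^{−wn}`; and `R^{(w)}_n = ∏_{s<w} F_{s+1}` is the product of `w` of Rivoal's
bricks `F_l(u) = (u − nl + 1)_n/(u+1)_{n+1}` (`BallRivoal.F_eq_brickEval`, integer residues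
`BallRivoal.resF`), so `BallRivoal.exists_pf_prod` expands it as
`∑_{p ≤ n} ∑_{o < w} c_{o,p}/(u+p+1)^{o+1}` with `d_n^{w−1−o} c_{o,p} ∈ ℤ` and `∑|c| ≤ w!·2^{O(w²)n}`;
summing against `x^{u+1}` gives `S^{(w)}_n(1/N) = ∑_{o<w} a_o Li_{o+1}(1/N) + a` with
`a_o = coefW n c N o = ∑_p c_{o,p} N^p` and the constant `constW n w c N`. Definitions only; the
identities, bounds and the independence of `1, Li₁(1/N), …, Li_w(1/N)` for `N ≥ N₀(w)` are proved
in the sibling files `PolylogHermitePade*.lean` / `PolylogLinearIndependence.lean`.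

References: E. M. Nikišin, Mat. Sb. 109 (1979); M. Hata, J. Math. Pures Appl. 69 (1990);
S. David, N. Hirata-Kohno, M. Kawashima, Moscow J. Comb. Number Th. 9 (2020), Thm 2.1;
T. Rivoal, C. R. Acad. Sci. Paris 331 (2000), §2 (the bricks `F_l`).
-/

noncomputable section

open Finset

namespace Literature.NumberTheory.DiophantineApproximation

namespace PolylogPade

open Literature.NumberTheory.Transcendental

/-- The weight-`w` type-I Hermite–Padé kernel `R^{(w)}_n(u) = (u − wn + 1)_{wn} / (u+1)_{n+1}^w
= ∏_{j<wn}(u − j)/∏_{p≤n}(u+p+1)^w`, as a rational function of `u : ℚ` (junk value `x/0 = 0` at the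
poles `u = −1, …, −(n+1)`, never used). [cite: DavidHirataKohnoKawashima2020, Thm 2.1] -/
def kernelW (w n : ℕ) (u : ℚ) : ℚ :=
  BallRivoal.poch (u - w * n + 1) (w * n) / BallRivoal.poch (u + 1) (n + 1) ^ w

/-- The weight-`w` Hermite–Padé form `S^{(w)}_n(x) = ∑_{u ≥ 0} R^{(w)}_n(u) x^{u+1}` (a real `tsum`;
absolutely convergent for `|x| < 1` since `|R^{(w)}_n(u)| ≤ 1` at the naturals).
[cite: DavidHirataKohnoKawashima2020, Thm 2.1] -/
def formW (w n : ℕ) (x : ℝ) : ℝ := ∑' u : ℕ, (kernelW w n u : ℝ) * x ^ (u + 1)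

/-- The coefficient of `Li_{o+1}(1/N)` in `S^{(w)}_n(1/N)` attached to partial-fraction data `c`
(coefficient `c o p` of `1/(u+p+1)^{o+1}`): `a_o = ∑_{p ≤ n} c_{o,p} N^p`. [folklore] -/
def coefW (n : ℕ) (c : ℕ → ℕ → ℚ) (N o : ℕ) : ℚ := ∑ p ∈ range (n + 1), c o p * (N : ℚ) ^ p

/-- The constant term of `S^{(w)}_n(1/N)` attached to partial-fraction data `c`:
`−∑_{o<w} ∑_{p≤n} c_{o,p} ∑_{1 ≤ m ≤ p} N^p/(N^m m^{o+1})`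
(from `∑_{u≥0} N^{−(u+1)}/(u+p+1)^s = N^p (Li_s(1/N) − ∑_{m=1}^{p} N^{−m}/m^s)`). [folklore] -/
def constW (n w : ℕ) (c : ℕ → ℕ → ℚ) (N : ℕ) : ℚ :=
  -∑ o ∈ range w, ∑ p ∈ range (n + 1),
    c o p * ∑ m ∈ Icc 1 p, (N : ℚ) ^ p / ((N : ℚ) ^ m * (m : ℚ) ^ (o + 1))

/-- The residues of the `w` bricks of the kernel: brick `s < w` is Rivoal's `F_{s+1}`, with residues
`(−1)^{n+m} C(n,m) C(m + n(s+1), n)` (`BallRivoal.resF n (s+1)`). [folklore] -/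
def bricksW (n : ℕ) (s : ℕ) : ℕ → ℤ := BallRivoal.resF n (s + 1)

end PolylogPade

end Literature.NumberTheory.DiophantineApproximation
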